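import Summits.QuantumAdvantage.QuantumAdvantage.Theorems.CubicForrelationNearExactIsExactFourteenSecondTypeOLowRank

/-!
# Crux `CubicForrelation.NearExactIsExact` (stmt-QuantumAdvantage-14043) — n = 14: a ONE-SIDED capacity corollary of the low-rank type-O kill

Certificate seat `b2b-cforr-cert` (gen 9).  HONEST FRAMING: a theorem about the Walsh CAPACITY `Σ_x |W_g(x)|` of certain cubic Boolean functions
on 14 bits (finite slice `n = 14`) — NOT summit progress.

`fo_lowrank_false` holds for EVERY Boolean partner `f`; taking the sign pattern `f₀(x) = [W_g(x) < 0]`, for which `2²¹·Φ(f₀,g) = Σ_x |W_g(x)|`,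
gives `fo_lowrank_capacity`: a type-O cubic `g` on 14 bits (`W_g = 32u`, all `u` odd) whose first digit `d₁ = [⌊u/2⌋ odd]` has a radical of size
`≥ 2¹²` (rank `≤ 2`) and with `d₁(x) = d₂(x)` for some `x` (`d₂ = [⌊u/4⌋ odd]`) has capacity `Σ_x |W_g(x)| < (15/16)·2²¹`.  (So in the
disprover's census language such `g` are never "cap-15/16" functions; the census maximum `15/16` over idempotents must come from rank `≥ 4` or
case A.)

References: as in the imported file.  Everything below is proved from Mathlib and the tree; axioms are the standard three.
-/

set_option linter.dupNamespace false -- D-0017: single-problem summit ⇒ `QuantumAdvantage.QuantumAdvantage` by design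

noncomputable section

namespace Summit.QuantumAdvantage.QuantumAdvantage.Theorems.CubicForrelation.NearExactIsExact

open Finset
open Literature.Computability.QuantumComplexity
open Literature.Computability.QuantumComplexity.BuzetChailloux (bxor zeroVec)
open Literature.Computability.QuantumComplexity.DerivativeWalsh (W)

/-- The sign-pattern partner attains the capacity: with `f₀(x) = [W_g(x) < 0]`, `2^{3m}·Φ(f₀,g) = Σ_x |W_g(x)|`. [folklore] -/
theorem fo_forrelation_signPattern {m : ℕ} (g : (Fin (m + m) → Bool) → Bool) :
    (2 : ℝ) ^ (3 * m) * forrelation (fun x => decide (W (fun y => signOf (g y)) x < 0)) g = ∑ x, |W (fun y => signOf (g y)) x| := by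
  rw [vg_two_pow_mul_forrelation]
  refine sum_congr rfl fun x _ => ?_
  by_cases h : W (fun y => signOf (g y)) x < 0
  · rw [decide_eq_true h, abs_of_neg h]; simp [signOf]
  · rw [decide_eq_false h, abs_of_nonneg (not_lt.1 h)]; simp [signOf]

/-- **Capacity below `15/16` for low-rank type-O cubics on 14 bits.**  For a cubic `g : 𝔽₂¹⁴ → 𝔽₂` with `W_g = 32u`, all `u(x)` odd, the
radical of the first digit of size `≥ 2¹²` and `[⌊u(x)/2⌋ odd] = [⌊u(x)/4⌋ odd]` for some `x`:  `Σ_x |W_g(x)| < (15/16)·2²¹`.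
One-sided (capacity) statement; NOT summit progress. [this work] -/
theorem fo_lowrank_capacity (g : (Fin (7 + 7) → Bool) → Bool) (hg : IsDegLeFun 3 g)
    (u : (Fin (7 + 7) → Bool) → ℤ) (hu : ∀ x, W (fun y => signOf (g y)) x = (2 : ℝ) ^ 5 * (u x : ℝ))
    (hodd : ∀ x, Odd (u x))
    (hrad : 2 ^ 12 ≤ #(univ.filter fun a : Fin (7 + 7) → Bool => ∀ b,
      (decide (Odd (u zeroVec / 2)) ^^ decide (Odd (u a / 2)) ^^ decide (Odd (u b / 2)) ^^ decide (Odd (u (bxor a b) / 2))) = false))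
    (hEne : ∃ x, (Odd (u x / 2) ↔ Odd (u x / 2 / 2))) :
    ∑ x, |W (fun y => signOf (g y)) x| < (15 / 16 : ℝ) * (2 : ℝ) ^ 21 := by
  by_contra hge
  push Not at hge
  have hcap := fo_forrelation_signPattern (m := 7) g
  have hΦ : (15 / 16 : ℝ) ≤ forrelation (fun x => decide (W (fun y => signOf (g y)) x < 0)) g := by
    have h21 : (2 : ℝ) ^ (3 * 7) = 2 ^ 21 := by norm_num
    rw [h21] at hcap
    nlinarith
  exact fo_lowrank_false _ g hg u hu hodd hrad hEne hΦ

end Summit.QuantumAdvantage.QuantumAdvantage.Theorems.CubicForrelation.NearExactIsExact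

end
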